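import Literature.AnabelianGeometry.EtaleTheta.Discharge.Sec2Cor218ivTrivialBase
import HarnessLib

/-!
# [EtTh] Cor. 2.18 (iv) for `ThetaEnvData` with `G_K = 1` — SHARP forms: lifts with a homomorphism part,
# and the coefficient-rigidity criterion for the fibre clause (proof-only)

S. Mochizuki, *The Étale Theta Function …* [EtTh], Publ. RIMS **45** (2009), §2, Cor. 2.18 (iv), PRIMS text
pp. 61–63 (locators `p.N` = PDF pages; bib key `MochizukiEtTh2009`).

PROOF-ONLY sequel (no `def`, no instance, no new named fact) of `Sec2Cor218ivTrivialBase.lean` (same seat).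
With `G_K = 1` the envelope is `μ_N × Π^tp_Y`, and EVERY bi-continuous automorphism of it lying over an
automorphism `γ` of `Π^tp_Y` has the shape `(u, y) ↦ (ψ u · f(y), γ y)` with `ψ ∈ Aut(μ_N)` and
`f ∈ Hom(Π^tp_Y, μ_N)`.  Accordingly:

* `exists_iso_over_of_coeff_hom` — LIFTING with a homomorphism part: if `D_Y = 1`, `γ` preserves
  `Π^tp_Y`, `Π^tp_Ÿ`, and `ψ (η y) = f(y) · η(γ y)` on `Π^tp_Ÿ` for a continuous `f`, then
  `(u, y) ↦ (ψ u · f(y), γ y)` is a model automorphism of `M(η)` over `γ|_{Π^tp_Y}` (the case `f = 1` is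
  `exists_iso_over_of_coeff`);
* `cor218_iv_fibre_of_coeff_rigid` — the SHARP rigidity criterion: if the only `ψ ∈ Aut(μ_N)` for which
  `(ψ ∘ η) · η⁻¹` extends from `Π^tp_Ÿ` to a homomorphism on `Π^tp_Y` is `ψ = id`, then every model
  automorphism over `id_{Π^tp_Y}` is the twist by a homomorphism killing `Π^tp_Ÿ`, i.e. `Cor218_iv_fibre`
  holds with `c = 1` (the case `Hom(Π^tp_Y, μ_N) = 1`, `η` onto, is `cor218_iv_fibre_of_rigid`).

These are the forms needed by toys whose `Π^tp_Y` has nontrivial `Hom(Π^tp_Y, μ_N)` (e.g. a discrete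
Heisenberg skeleton of `(Π^tp_X)^Θ`).  HONEST FRAMING: statements about the cell's own typing over an
abstract interface; nothing here bears on [EtTh] (refereed) or on [IUTchIII] Cor. 3.12; no side taken;
typed ≠ proved.  Cell `abc-iut`, seat abc-iut-f-151 (tranche 151).
-/

namespace Literature.AnabelianGeometry.EtaleTheta

universe u

namespace ThetaEnvData

variable {N : ℕ+} (T : ThetaEnvData.{u} N)

section SubsingletonG

variable [Subsingleton T.G]

/-- **Lifting criterion with a homomorphism part** (`G_K = 1`, `D_Y = 1`): an automorphism `γ` of
`Π^tp_X` preserving `Π^tp_Y`, `Π^tp_Ÿ`, a coefficient automorphism `ψ` and a CONTINUOUS homomorphism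
`f : Π^tp_Y → μ_N` with `ψ (η y) = f(y) · η (γ y)` on `Π^tp_Ÿ` give the model automorphism
`(u, y) ↦ (ψ u · f(y), γ y)` of `M(η)` over `γ|_{Π^tp_Y}`. [cite: MochizukiEtTh2009, Cor 2.18(iv) p.61] -/
theorem exists_iso_over_of_coeff_hom (hD : T.DY = ⊥) {η : T.PiYdd → T.mu} (hη : η ∈ T.thetaCocycles)
    (γ : T.PiX ≃ₜ* T.PiX) (hY : ∀ g : T.PiX, g ∈ T.PiY → γ g ∈ T.PiY)
    (hY' : ∀ g : T.PiX, g ∈ T.PiY → γ.symm g ∈ T.PiY)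
    (hdd : ∀ g : T.PiX, g ∈ T.PiYdd → γ g ∈ T.PiYdd)
    (hdd' : ∀ g : T.PiX, g ∈ T.PiYdd → γ.symm g ∈ T.PiYdd)
    (ψ : T.mu ≃* T.mu) (f : T.PiY →* T.mu) (hf : Continuous f)
    (hψ : ∀ y : T.PiYdd, ψ (η y) = f (T.inclYdd y) * η ⟨γ y, hdd y y.2⟩) :
    ∃ α : (T.modelMono hη).Iso (T.modelMono hη),
      ∀ x : T.env, ((CycEnvelope.proj T.augY T.chi (α.e x) : T.PiY) : T.PiX) =
        γ ((CycEnvelope.proj T.augY T.chi x : T.PiY) : T.PiX) := by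
  -- the restriction of `γ`, `γ⁻¹` to `Π^tp_Y`
  let gY : T.PiY → T.PiY := fun y => ⟨γ (y : T.PiX), hY _ y.2⟩
  let gY' : T.PiY → T.PiY := fun y => ⟨γ.symm (y : T.PiX), hY' _ y.2⟩
  have hgg' : ∀ y, gY (gY' y) = y := fun y => Subtype.ext (γ.apply_symm_apply (y : T.PiX))
  have hg'g : ∀ y, gY' (gY y) = y := fun y => Subtype.ext (γ.symm_apply_apply (y : T.PiX))
  have hgmul : ∀ y y' : T.PiY, gY (y * y') = gY y * gY y' := fun y y' =>
    Subtype.ext (by change γ ((y : T.PiX) * y') = γ y * γ y'; rw [map_mul])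
  -- the automorphism `A₀ : (a, y) ↦ (ψ a · f y, γ y)`
  let A₀ : MulAut T.env :=
    { toFun := fun x => ⟨ψ x.left * f x.right, gY x.right⟩
      invFun := fun x => ⟨ψ.symm (x.left * (f (gY' x.right))⁻¹), gY' x.right⟩
      left_inv := fun x => by
        refine SemidirectProduct.ext ?_ ?_
        · change ψ.symm (ψ x.left * f x.right * (f (gY' (gY x.right)))⁻¹) = x.left
          rw [hg'g, mul_inv_cancel_right, MulEquiv.symm_apply_apply]
        · exact hg'g x.right
      right_inv := fun x => by
        refine SemidirectProduct.ext ?_ ?_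
        · change ψ (ψ.symm (x.left * (f (gY' x.right))⁻¹)) * f (gY' x.right) = x.left
          rw [MulEquiv.apply_symm_apply, inv_mul_cancel_right]
        · exact hgg' x.right
      map_mul' := fun x y => by
        refine SemidirectProduct.ext ?_ ?_
        · change ψ (x * y).left * f (x * y).right = _
          rw [mul_left_eq, mul_left_eq, map_mul, SemidirectProduct.mul_right, map_mul]
          exact mul_mul_mul_comm _ _ _ _
        · change gY (x * y).right = gY x.right * gY y.right
          rw [SemidirectProduct.mul_right, hgmul] }
  -- continuity of `A₀`
  have hlc : Continuous fun x : T.env => x.left :=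
    (continuous_fst.comp continuous_induced_dom :
      Continuous (Prod.fst ∘ fun x : T.env => (x.left, x.right)))
  have hrc₀ : Continuous fun x : T.env => x.right :=
    (continuous_snd.comp continuous_induced_dom :
      Continuous (Prod.snd ∘ fun x : T.env => (x.left, x.right)))
  have hrc : Continuous fun x : T.env => ((x.right : T.PiY) : T.PiX) :=
    continuous_subtype_val.comp hrc₀
  have hgYc : Continuous gY := (γ.continuous.comp continuous_subtype_val).subtype_mk _
  have hgY'c : Continuous gY' := (γ.symm.continuous.comp continuous_subtype_val).subtype_mk _
  have hA₀c : A₀ ∈ contMulAut T.env := by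
    refine ⟨?_, ?_⟩
    · refine continuous_induced_rng.2 ?_
      change Continuous fun x : T.env => ((ψ x.left * f x.right, gY x.right) : T.mu × T.PiY)
      exact (((continuous_of_discreteTopology (f := fun a : T.mu => ψ a)).comp hlc).mul
        (hf.comp hrc₀)).prodMk (hgYc.comp hrc₀)
    · refine continuous_induced_rng.2 ?_
      change Continuous fun x : T.env =>
        ((ψ.symm (x.left * (f (gY' x.right))⁻¹), gY' x.right) : T.mu × T.PiY)
      exact ((continuous_of_discreteTopology (f := fun a : T.mu => ψ.symm a)).comp
        (hlc.mul ((hf.comp (hgY'c.comp hrc₀)).inv))).prodMk (hgY'c.comp hrc₀)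
  set cA : contMulAut T.env := ⟨A₀, hA₀c⟩ with hcA
  -- `A₀` carries `s^Θ(y)` to `s^Θ(γ y)`
  have hAs : ∀ y : T.PiYdd, A₀ (T.sTheta hη y) = T.sTheta hη ⟨γ y, hdd y y.2⟩ := by
    intro y
    refine SemidirectProduct.ext ?_ (Subtype.ext rfl)
    change ψ (η y)⁻¹ * f (T.inclYdd y) = (η ⟨γ y, hdd y y.2⟩)⁻¹
    rw [map_inv, hψ, mul_inv_rev, inv_mul_cancel_right]
  have hs : (T.sTheta hη).range.map (cA : MulAut T.env).toMonoidHom = (T.sTheta hη).range := by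
    ext x
    constructor
    · rintro ⟨_, ⟨y, rfl⟩, rfl⟩
      exact ⟨⟨γ y, hdd y y.2⟩, (hAs y).symm⟩
    · rintro ⟨y, rfl⟩
      refine ⟨_, ⟨⟨γ.symm y, hdd' y y.2⟩, rfl⟩, ?_⟩
      change A₀ _ = _
      rw [hAs]
      exact congrArg _ (Subtype.ext (γ.apply_symm_apply (y : T.PiX)))
  have hDmap : T.DY.map (MulAut.conj (TopOut.mk _ cA)).toMonoidHom = T.DY := by
    rw [hD, Subgroup.map_bot]
  have hμ : ∀ a, (cA : MulAut T.env) (CycEnvelope.inMu T.augY T.chi a) =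
      CycEnvelope.inMu T.augY T.chi (ψ a) := fun a => by
    refine SemidirectProduct.ext ?_ ?_
    · change ψ (CycEnvelope.inMu T.augY T.chi a).left * f (CycEnvelope.inMu T.augY T.chi a).right = _
      rw [SemidirectProduct.left_inl, SemidirectProduct.right_inl, map_one, mul_one]
      rfl
    · change gY (CycEnvelope.inMu T.augY T.chi a).right = (CycEnvelope.inMu T.augY T.chi (ψ a)).right
      apply Subtype.ext
      change γ (((CycEnvelope.inMu T.augY T.chi a).right : T.PiY) : T.PiX) =
        (((CycEnvelope.inMu T.augY T.chi (ψ a)).right : T.PiY) : T.PiX)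
      simp
  obtain ⟨α, hα⟩ := T.exists_modelIso_of_aut' hη hη cA hDmap
    (fun a => ⟨ψ a, hμ a⟩) (fun b => ⟨ψ.symm b, by rw [hμ, MulEquiv.apply_symm_apply]⟩) hs
  exact ⟨α, fun x => by rw [hα]; rfl⟩

omit [Subsingleton T.G] in
/-- An automorphism `A` of the envelope over `id_{Π^tp_Y}` maps the cyclotome into itself:
`A(a) = ((A a)_μ, 1)`. [cite: MochizukiEtTh2009, Cor 2.18(iv) p.63] -/
theorem apply_inMu_eq_of_over_id (A : MulAut T.env) (hA : ∀ x, (A x).right = x.right) (a : T.mu) :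
    A (CycEnvelope.inMu T.augY T.chi a) =
      CycEnvelope.inMu T.augY T.chi (A (CycEnvelope.inMu T.augY T.chi a)).left := by
  ext
  · simp
  · rw [hA]; simp

/-- **Cor. 2.18 (iv), fibres — the SHARP rigidity criterion for `G_K = 1` data.**  An automorphism of
the model `M(η)` over `id_{Π^tp_Y}` is `(u, y) ↦ (ψ u · f(y), y)` with `ψ ∈ Aut(μ_N)`, `f ∈ Hom(Π^tp_Y, μ_N)`
and `f|_{Π^tp_Ÿ} = (ψ ∘ η) · η⁻¹` (it fixes `s^Θ` pointwise); so IF the only coefficient automorphism `ψ`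
for which `(ψ ∘ η) · η⁻¹` extends to a homomorphism on `Π^tp_Y` is the identity (`hrig`), then every
such automorphism is the twist by an `f` killing `Π^tp_Ÿ` — the fibre clause, with `c = 1` (the
converse clause is `exists_iso_eq_twist`). [cite: MochizukiEtTh2009, Cor 2.18(iv) p.63] -/
theorem cor218_iv_fibre_of_coeff_rigid
    (hrig : ∀ (η : T.PiYdd → T.mu), η ∈ T.thetaCocycles → ∀ (ψ : T.mu ≃* T.mu) (f : T.PiY →* T.mu),
      (∀ y : T.PiYdd, f (T.inclYdd y) = ψ (η y) * (η y)⁻¹) → ψ = MulEquiv.refl T.mu) :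
    Literature.AnabelianGeometry.EtaleTheta.ThetaEnvData.Cor218_iv_fibre T := by
  classical
  intro η hη
  refine ⟨fun α hα => ?_, fun φ hφ => T.exists_iso_eq_twist hη φ hφ⟩
  let A : MulAut T.env := α.e.toMulEquiv
  have hAe : ∀ x, α.e x = A x := fun x => rfl
  have hAright : ∀ x, (A x).right = x.right := hα
  -- the homomorphism part `f : y ↦ (A s^alg(y))_μ`
  let sY : T.PiY →* T.env := CycEnvelope.algSection T.augY T.chi
  let f : T.PiY →* T.mu := MonoidHom.mk' (fun y => (A (sY y)).left) (fun y y' => by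
    change (A (sY (y * y'))).left = (A (sY y)).left * (A (sY y')).left
    rw [map_mul, map_mul, mul_left_eq])
  have hAsY : ∀ y, A (sY y) = ⟨f y, y⟩ := fun y =>
    SemidirectProduct.ext rfl (by rw [hAright]; rfl)
  -- the coefficient part `ψ : a ↦ (A a)_μ`, an automorphism of the (finite) cyclotome
  let ψh : T.mu →* T.mu := MonoidHom.mk' (fun a => (A (CycEnvelope.inMu T.augY T.chi a)).left)
    (fun a b => by rw [map_mul, map_mul, mul_left_eq])
  have hAμ : ∀ a, A (CycEnvelope.inMu T.augY T.chi a) = CycEnvelope.inMu T.augY T.chi (ψh a) :=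
    fun a => T.apply_inMu_eq_of_over_id A hAright a
  have hψinj : Function.Injective ψh := by
    intro a b hab
    have h1 : A (CycEnvelope.inMu T.augY T.chi a) = A (CycEnvelope.inMu T.augY T.chi b) := by
      rw [hAμ, hAμ]
      exact congrArg _ hab
    exact SemidirectProduct.inl_injective (A.injective h1)
  let ψ : T.mu ≃* T.mu :=
    MulEquiv.ofBijective ψh ⟨hψinj, Finite.injective_iff_surjective.mp hψinj⟩
  -- on `Π^tp_Ÿ`: `f = (ψ ∘ η) · η⁻¹`, since `A` fixes `s^Θ` pointwise
  have hfdd : ∀ y : T.PiYdd, f (T.inclYdd y) = ψ (η y) * (η y)⁻¹ := by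
    intro y
    have h1 : sY (T.inclYdd y) = CycEnvelope.inMu T.augY T.chi (η y) * T.sTheta hη y := by
      ext
      · simp [sY, ThetaEnvData.sTheta]
      · simp [sY, ThetaEnvData.sTheta]
    have h2 : A (sY (T.inclYdd y)) =
        CycEnvelope.inMu T.augY T.chi (ψh (η y)) * T.sTheta hη y := by
      rw [h1, map_mul, hAμ, ← hAe (T.sTheta hη y), T.iso_apply_sTheta_of_over_id hη α hα y]
    have h3 := congrArg SemidirectProduct.left h2
    rw [hAsY, mul_left_eq, SemidirectProduct.left_inl] at h3
    exact h3
  have hψ1 : ψ = MulEquiv.refl T.mu := hrig η hη ψ f hfdd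
  have hψid : ∀ a, ψh a = a := fun a => by
    change ψ a = a
    rw [hψ1]
    rfl
  -- conclusion: `α = twist by f`, `c = 1`
  have hfkill : ∀ y : T.PiYdd, f (T.inclYdd y) = 1 := fun y => by
    rw [hfdd y]
    change ψh (η y) * (η y)⁻¹ = 1
    rw [hψid, mul_inv_cancel]
  refine ⟨f, hfkill, 1, fun x => ?_⟩
  rw [hAe, map_one, map_one, MulAut.one_apply]
  calc A x = A (CycEnvelope.inMu T.augY T.chi x.left * sY x.right) := by
        rw [CycEnvelope.inMu_mul_algSection]
    _ = CycEnvelope.inMu T.augY T.chi x.left * ⟨f x.right, x.right⟩ := by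
        rw [map_mul, hAμ, hψid, hAsY]
    _ = CycEnvelope.inMu T.augY T.chi (f (CycEnvelope.proj T.augY T.chi x)) * x := by
        refine SemidirectProduct.ext ?_ ?_
        · rw [mul_left_eq, mul_left_eq, SemidirectProduct.left_inl, SemidirectProduct.left_inl]
          exact mul_comm _ _
        · simp

end SubsingletonG

end ThetaEnvData

end Literature.AnabelianGeometry.EtaleTheta
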